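import Summits.QuantumFields.GaugeBoot.EquipartitionBound
import Summits.QuantumFields.GaugeBoot.SUNWeakCouplingRate
import HarnessLib

/-!
# Gauge-boot: the equipartition bound at every infinite-volume limit point, and the TWO-SIDED analytic
# weak-coupling window (large-`N` supplement 18, part 4c)

HONEST FRAMING (cell `pub-gaugeboot`, page 1 of every file): certified bounds on lattice
expectations at STATED coupling, gauge group, dimension and torus size; NOT a mass gap, NOT a
continuum limit, NOT a string tension, NOT large `N`; NOT Yang–Mills-summit-bearing (barriers
`FixedCouplingUltralocality`, `PerturbativeInvisibility`).  Analytic bounds, uniform in the volume, far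
weaker than the SDP certificates at the cell's couplings; no uniqueness of the infinite-volume limit is
claimed; no number of CERTIFIED.md is certified here.

## Content

Part 4b's bound `plaquetteExpectation N D L β_std ≤ 1 − (N² − 1)/(4(D−1)β_std + N² − 1)` holds for EVERY torus
side `L ≥ 2`, so it survives the thermodynamic limit (as part 3's lower bound did):

* ★★★ `Equipartition.integral_plaquette_le_of_mem_limitPoints` — for `SU(N)`, `N ≥ 2`, `D ≥ 2`, `β_std ≥ 0`,
  every `μ ∈ infiniteVolumeLimitPoints (suRep N) (β_std/N)` (any subsequence of sides) and every plaquette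
  `(x; i ≠ j)` of `ℤ^D`: `∫ (1/N) Re tr U_P dμ ≤ 1 − (N² − 1)/(4(D−1)β_std + N² − 1)`;
* ★★★ `Equipartition.plaquetteWindow_twoSided` — for `N ≥ 2`, `D ≥ 2`, `β_std ≥ N`, every `L₀ ≥ 2`:
  `PlaquetteWindow N D L₀ β_std (1 − (2 + (4N²/(D−1))(log(144N²) + log(β_std/N)))/β_std) (1 − (N² − 1)/(4(D−1)β_std + N² − 1))`
  — the plaquette deficit `1 − ⟨ū_P⟩` is pinned between `c_N/β_std` (equipartition, parts 4a–b) and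
  `C_{N,D}·log β_std/β_std` (Laplace + covering, parts 1–3) on every torus, analytically;
  `integral_plaquette_mem_Icc_of_mem_limitPoints` — the same bracket at every infinite-volume limit point.
[folklore]
-/

noncomputable section

open MeasureTheory Filter Topology
open Literature.MathematicalPhysics.QuantumFieldTheory
open Literature.MathematicalPhysics.QuantumLattice (LGConfig plaquetteObs plaquetteHolonomyZd IsCylinder
  IsInfiniteVolumeLimitAlong infiniteVolumeLimitPoints fundamentalRep_apply)
open Literature.RepresentationTheory.CompactGroups

namespace Summit.QuantumFields.GaugeBoot

namespace Equipartition

/-- ★★★ **The equipartition bound at every infinite-volume limit point.**  For `SU(N)`, `N ≥ 2`, `D ≥ 2`,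
`β_std ≥ 0`, every `μ ∈ infiniteVolumeLimitPoints (suRep N) (β_std/N)` and every plaquette `(x; i ≠ j)` of `ℤ^D`:
`∫ (1/N) Re tr U_P dμ ≤ 1 − (N² − 1)/(4(D−1)β_std + N² − 1)`. [folklore] -/
theorem integral_plaquette_le_of_mem_limitPoints {N D : ℕ} (hN : 2 ≤ N) (hD : 2 ≤ D) {β : ℝ} (hβ : 0 ≤ β)
    {μ : Measure (LGConfig D (SU N))} (hμ : μ ∈ infiniteVolumeLimitPoints (d := D) (suRep N) (β / N))
    (x : Literature.Probability.LatticeModels.Site D) {i j : Fin D} (hij : i ≠ j) :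
    ∫ U, (N : ℝ)⁻¹ * plaquetteObs (suRep N) x i j U ∂μ ≤
      1 - ((N : ℝ) ^ 2 - 1) / (4 * ((D : ℝ) - 1) * β + ((N : ℝ) ^ 2 - 1)) := by
  obtain ⟨Lk, hmono, hlim⟩ := hμ
  have hN0 : N ≠ 0 := by omega
  have hNpos : (0 : ℝ) < N := by exact_mod_cast Nat.pos_of_ne_zero hN0
  set F : LGConfig D (SU N) → ℝ := fun U => (N : ℝ)⁻¹ * plaquetteObs (suRep N) x i j U with hF
  have hcyl : IsCylinder F ({(x, i), (x + Pi.single i 1, j), (x + Pi.single j 1, i), (x, j)} :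
      Finset (Literature.MathematicalPhysics.QuantumLattice.ZdEdge D)) := by
    intro U V hUV
    simp only [hF, plaquetteObs, plaquetteHolonomyZd]
    rw [hUV (x, i) (by simp), hUV (x + Pi.single i 1, j) (by simp), hUV (x + Pi.single j 1, i) (by simp),
      hUV (x, j) (by simp)]
  have hcont : Continuous F := by
    have h1 : Continuous fun U : LGConfig D (SU N) => plaquetteHolonomyZd U x i j := by
      unfold plaquetteHolonomyZd; fun_prop
    exact continuous_const.mul ((continuous_trace_re (suRep N) (continuous_suRep N)).comp h1)
  have hbd : ∃ C, ∀ U, |F U| ≤ C := by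
    refine ⟨1, fun U => ?_⟩
    have h := CompactGroup.abs_re_trace_le_card (suRep N) (continuous_suRep N) (plaquetteHolonomyZd U x i j)
    rw [Fintype.card_fin] at h
    simp only [hF, plaquetteObs]
    rw [abs_mul, abs_inv, Nat.abs_cast]
    calc (N : ℝ)⁻¹ * |((suRep N) (plaquetteHolonomyZd U x i j)).trace.re| ≤ (N : ℝ)⁻¹ * N := by gcongr
      _ = 1 := inv_mul_cancel₀ hNpos.ne'
  have htend := hlim.2 F _ hcyl hcont hbd
  have hFt : ∀ L : ℕ, Literature.MathematicalPhysics.QuantumLattice.toTorusObservable L F =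
      plaquetteTrace (suRep N) (Literature.Probability.LatticeModels.Torus.proj L x) i j := fun L =>
    toTorusObservable_plaquetteObs (suRep N) L x i j
  simp only [hFt] at htend
  -- on every torus of side `≥ 2` the single-plaquette expectation is the mean plaquette, bounded above uniformly
  have hev : ∀ᶠ k in atTop,
      wilsonExpectation (suRep N) (β / N)
        (plaquetteTrace (suRep N) (Literature.Probability.LatticeModels.Torus.proj (Lk k + 1) x) i j) ≤
      1 - ((N : ℝ) ^ 2 - 1) / (4 * ((D : ℝ) - 1) * β + ((N : ℝ) ^ 2 - 1)) := by
    refine Filter.eventually_atTop.2 ⟨1, fun k hk => ?_⟩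
    have hL : 2 ≤ Lk k + 1 := Nat.succ_le_succ (hk.trans (hmono.id_le k))
    have h := plaquetteExpectation_le_one_sub (N := N) (D := D) (L := Lk k + 1) hN hL hD hβ
    unfold plaquetteExpectation at h
    rwa [wilsonExpectation_meanPlaquette_eq_plaquetteTrace (suRep N) (continuous_suRep N) (β / N)
      (Literature.Probability.LatticeModels.Torus.proj (Lk k + 1) x) hij] at h
  exact le_of_tendsto htend hev

/-- ★★★ **The two-sided analytic weak-coupling window.**  For `SU(N)`, `N ≥ 2`, `D ≥ 2`, `β_std ≥ N` and every
`L₀ ≥ 2`: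
`PlaquetteWindow N D L₀ β_std (1 − (2 + (4N²/(D−1))(log(144N²) + log(β_std/N)))/β_std) (1 − (N² − 1)/(4(D−1)β_std + N² − 1))`
— equipartition from below the deficit, Laplace–covering from above, uniformly in the volume. [folklore] -/
theorem plaquetteWindow_twoSided {N D L₀ : ℕ} (hN : 2 ≤ N) (hD : 2 ≤ D) (hL₀ : 2 ≤ L₀) {β : ℝ} (hβ : (N : ℝ) ≤ β) :
    PlaquetteWindow N D L₀ β
      (1 - (2 + 4 * (N : ℝ) ^ 2 / ((D : ℝ) - 1) * (Real.log (144 * (N : ℝ) ^ 2) + Real.log (β / N))) / β)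
      (1 - ((N : ℝ) ^ 2 - 1) / (4 * ((D : ℝ) - 1) * β + ((N : ℝ) ^ 2 - 1))) := by
  have hN0 : N ≠ 0 := by omega
  have hβ0 : 0 ≤ β := le_trans (Nat.cast_nonneg N) hβ
  intro L _ _ hL
  refine ⟨?_, plaquetteExpectation_le_one_sub hN (hL₀.trans hL) hD hβ0⟩
  have h := SUNRate.one_sub_plaquetteExpectation_le (N := N) (D := D) (L := L) hN0 hD hβ
  linarith

/-- The two-sided bracket at every infinite-volume limit point: for `SU(N)`, `N ≥ 2`, `D ≥ 2`, `β_std ≥ N`, every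
`μ ∈ infiniteVolumeLimitPoints (suRep N) (β_std/N)` and every plaquette of `ℤ^D`,
`∫ (1/N) Re tr U_P dμ ∈ [1 − (2 + (4N²/(D−1))(log(144N²) + log(β_std/N)))/β_std, 1 − (N² − 1)/(4(D−1)β_std + N² − 1)]`. [folklore] -/
theorem integral_plaquette_mem_Icc_of_mem_limitPoints {N D : ℕ} (hN : 2 ≤ N) (hD : 2 ≤ D) {β : ℝ} (hβ : (N : ℝ) ≤ β)
    {μ : Measure (LGConfig D (SU N))} (hμ : μ ∈ infiniteVolumeLimitPoints (d := D) (suRep N) (β / N))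
    (x : Literature.Probability.LatticeModels.Site D) {i j : Fin D} (hij : i ≠ j) :
    ∫ U, (N : ℝ)⁻¹ * plaquetteObs (suRep N) x i j U ∂μ ∈
      Set.Icc (1 - (2 + 4 * (N : ℝ) ^ 2 / ((D : ℝ) - 1) * (Real.log (144 * (N : ℝ) ^ 2) + Real.log (β / N))) / β)
        (1 - ((N : ℝ) ^ 2 - 1) / (4 * ((D : ℝ) - 1) * β + ((N : ℝ) ^ 2 - 1))) := by
  have hN0 : N ≠ 0 := by omega
  have hβ0 : 0 ≤ β := le_trans (Nat.cast_nonneg N) hβ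
  refine ⟨?_, integral_plaquette_le_of_mem_limitPoints hN hD hβ0 hμ x hij⟩
  have h := SUNRate.one_sub_integral_plaquette_le_of_mem_limitPoints (N := N) (D := D) hN0 hD hβ hμ x hij
  linarith

end Equipartition

end Summit.QuantumFields.GaugeBoot

end
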